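import Literature.Analysis.OperatorTheory.BanachComplexification
import Literature.Analysis.OperatorTheory.QuasiCompactSpectralGap
import Literature.Analysis.OperatorTheory.RieszProjectionDichotomy
import Literature.Analysis.OperatorTheory.RieszProjectionCompactDifference
import Literature.Analysis.OperatorTheory.PseudoStableSteering
import HarnessLib

/-!
# Route `FilamentSkeletonRss`, crux `RdssProfileTruncation` (stmt-NavierStokesRegularity-11289),
  line `Sketch` — stub `stub_pseudoStableSteering`

The abstract "finite-codimension steering onto a pseudo-stable manifold" theorem used by the
blow-up construction: `T` is a self-map of a real Banach space with `T 0 = 0`, strictly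
differentiable at `0` with quasi-compact derivative `M = S + K` (`‖Sⁿ‖ ≤ C θ₀ⁿ`, `θ₀ < 1`, `K`
compact), and `D` is a dense submodule; then for every `η > 0` every sufficiently small `e` can
be corrected by some `d ∈ D` so that the whole forward orbit of `e + d` stays in the `η`-ball.

Proof (all ingredients are proved Literature files):

1. complexify `E ⊂ X` and lift `M, S, K` to `m = s + k`
   (`exists_banach_complexification`);
2. the spectrum of `m` outside radius `θ₀` consists of finitely many eigenvalues in
   `|z| ≥ (1+θ₀)/2`, so there is a spectrum-free annulus `a ≤ |z| ≤ b` with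
   `(1+θ₀)/2 < a < b < 1` (`exists_annulus_subset_resolventSet_of_add_compact`);
3. the Riesz projection `P` over `|z| = a` (= over `|z| = b`) is an idempotent commuting with
   `m` with `‖mⁿP‖ ≤ C aⁿ` (`norm_pow_mul_rieszProjection_le`), there is a backward family `J`
   with `J 0 = 1 − P`, `m J(n+1) = J n`, `‖J n‖ bⁿ ≤ C` (`exists_backward_family`,
   `exists_rieszProjection_eq_one`), and `1 − P = P(s) − P(m)` is compact
   (`rieszProjection_eq_one_of_norm_pow_le`, `isCompactOperator_rieszProjection_sub`);
4. the Lyapunov–Perron contraction plus finite-dimensional steering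
   (`exists_trapped_orbit_of_dichotomy`) gives the conclusion.
-/

noncomputable section

open Filter Topology Set Metric
open Literature.Analysis.OperatorTheory

-- the route's namespace `Summit.NavierStokesRegularity.NavierStokesRegularity.Theorems` repeats
-- the summit name by convention (summit = problem); silence the duplicate-namespace linter.
set_option linter.dupNamespace false

namespace Summit.NavierStokesRegularity.NavierStokesRegularity.Theorems

/-- **stub_pseudoStableSteering** (abstract finite-codimension steering; Lyapunov–Perron /
Irwin pseudo-stable manifold of a quasi-compact fixed point).  Let `T` be a self-map of a real
Banach space with `T 0 = 0`, strictly differentiable at `0` with derivative `M = S + K`, `K` compact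
and `‖Sⁿ‖ ≤ C θ₀ⁿ` for some `θ₀ < 1`, and let `D` be a dense submodule.  Then for every `η > 0`
there is `r > 0` such that every `e` with `‖e‖ < r` can be corrected by some `d ∈ D` so that the
whole forward orbit of `e + d` stays in the `η`-ball. See the module docstring for the proof
(complexification, Riesz splitting at a non-resonant radius, Lyapunov–Perron contraction,
finite-parameter steering). [cite: Henry1981, Thm. 5.2.1] -/
theorem stub_pseudoStableSteering :
    ∀ (E : Type) [NormedAddCommGroup E] [NormedSpace ℝ E] [CompleteSpace E]
      (T : E → E) (M S K : E →L[ℝ] E) (D : Submodule ℝ E) (Cs θ₀ : ℝ),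
      M = S + K → IsCompactOperator K → 0 ≤ θ₀ → θ₀ < 1 → (∀ n : ℕ, ‖S ^ n‖ ≤ Cs * θ₀ ^ n) →
      T 0 = 0 → HasStrictFDerivAt T M 0 → Dense (D : Set E) →
      ∀ η : ℝ, 0 < η → ∃ r : ℝ, 0 < r ∧ ∀ e : E, ‖e‖ < r →
        ∃ d ∈ D, ∀ k : ℕ, ‖T^[k] (e + d)‖ < η := by
  intro E _ _ _ T M S K D Cs θ₀ hM hK hθ₀ hθ₁ hS hT0 hT hD η hη
  -- 1. complexification
  obtain ⟨X, _, _, hcompl, ι, re, im, L, hιadd, hιsmul, hιnorm, hreadd, -, hrenorm, hreι, hreI,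
    hspan, hLadd, hLmul, hL1, hLnorm, hLre, -, hLc⟩ := exists_banach_complexification E
  haveI : CompleteSpace X := hcompl inferInstance
  set m : X →L[ℂ] X := L M with hmdef
  set s : X →L[ℂ] X := L S with hsdef
  set k : X →L[ℂ] X := L K with hkdef
  have hm : m = s + k := by rw [hmdef, hM, hLadd]
  have hk : IsCompactOperator k := hLc K hK
  have hLpow : ∀ n : ℕ, L (S ^ n) = s ^ n := by
    intro n
    induction n with
    | zero => rw [pow_zero, pow_zero, hL1]
    | succ n ih => rw [pow_succ, pow_succ, hLmul, ih]
  have hs : ∀ n : ℕ, ‖s ^ n‖ ≤ max Cs 1 * θ₀ ^ n := fun n => by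
    rw [← hLpow]
    exact (hLnorm _).trans ((hS n).trans
      (mul_le_mul_of_nonneg_right (le_max_left _ _) (pow_nonneg hθ₀ n)))
  -- 2. a spectrum-free annulus `a ≤ |z| ≤ b`, `(1+θ₀)/2 < a < b < 1`
  obtain ⟨a, b, ha1, hab, hb1, hann, hanns⟩ :=
    exists_annulus_subset_resolventSet_of_add_compact hm hk hθ₀
      (show θ₀ < (θ₀ + 1) / 2 by linarith) (show (θ₀ + 1) / 2 < 1 by linarith) hs
  have ha0 : 0 < a := by linarith
  have hb0 : 0 < b := ha0.trans hab
  have hθa : θ₀ < a := by linarith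
  have hsph : ∀ {r : ℝ}, a ≤ r → r ≤ b → ∀ {t : X →L[ℂ] X},
      closedBall (0 : ℂ) b \ ball 0 a ⊆ resolventSet ℂ t → sphere (0 : ℂ) r ⊆ resolventSet ℂ t := by
    intro r har hrb t ht z hz
    refine ht ⟨?_, ?_⟩
    · rw [mem_closedBall, dist_zero_right, mem_sphere_zero_iff_norm.1 hz]; exact hrb
    · rw [mem_ball, dist_zero_right, mem_sphere_zero_iff_norm.1 hz, not_lt]; exact har
  have hsa : sphere (0 : ℂ) a ⊆ resolventSet ℂ m := hsph le_rfl hab.le hann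
  have hsb : sphere (0 : ℂ) b ⊆ resolventSet ℂ m := hsph hab.le le_rfl hann
  have hsas : sphere (0 : ℂ) a ⊆ resolventSet ℂ s := hsph le_rfl hab.le hanns
  -- 3. the Riesz projection and the dichotomy data
  set P : X →L[ℂ] X := rieszProjection m 0 a with hPdef
  have hPb : rieszProjection m 0 b = P := by
    rw [hPdef, rieszProjection_def, rieszProjection_def,
      circleIntegral_resolvent_eq_of_annulus ha0 hab.le hann]
  have hPP : P * P = P := rieszProjection_mul_self ha0 hsa
  have hmP : m * P = P * m := (commute_rieszProjection ha0.le hsa).eq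
  obtain ⟨Mr, -, hMr⟩ := exists_norm_resolvent_le_of_sphere_subset hsa
  have hPn' : ∀ n : ℕ, ‖m ^ n * P‖ ≤ a * Mr * a ^ n := norm_pow_mul_rieszProjection_le ha0 hsa hMr
  obtain ⟨ρ₀, -, hρ⟩ := exists_rieszProjection_eq_one m
  obtain ⟨hsρ, hPρ⟩ := hρ (max ρ₀ b) (le_max_left _ _)
  obtain ⟨J, CJ, hJ0, hJ, hJn⟩ := exists_backward_family hb0 (le_max_right _ _) hsb hsρ
  rw [hPρ, hPb] at hJ0
  set C : ℝ := max (max (a * Mr) CJ) 1 with hCdef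
  have hC1 : 1 ≤ C := le_max_right _ _
  have hPn : ∀ n : ℕ, ‖m ^ n * P‖ ≤ C * a ^ n := fun n =>
    (hPn' n).trans (mul_le_mul_of_nonneg_right
      ((le_max_left _ _).trans (le_max_left _ _)) (pow_nonneg ha0.le n))
  have hJn' : ∀ n : ℕ, ‖J n‖ * b ^ n ≤ C := fun n =>
    (hJn n).trans ((le_max_right _ _).trans (le_max_left _ _))
  -- `1 − P = P(s) − P(m)` is compact
  have hPs : rieszProjection s 0 a = 1 :=
    rieszProjection_eq_one_of_norm_pow_le hθ₀ hs hθa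
      fun z hz => mem_resolventSet_of_norm_pow_le hθ₀ hs hz
  have hsm : (s - m : X →L[ℂ] X) = -k := by rw [hm]; abel
  have hQc : IsCompactOperator (⇑(1 - P : X →L[ℂ] X)) := by
    have hk' : IsCompactOperator (⇑(s - m : X →L[ℂ] X)) := by rw [hsm]; exact hk.neg
    have h := isCompactOperator_rieszProjection_sub hk' ha0 hsas hsa
    rwa [hPs] at h
  -- 4. Lyapunov–Perron + steering
  exact exists_trapped_orbit_of_dichotomy hιadd hιsmul hιnorm hreadd hrenorm hreι hreI
    (fun v => ⟨re v, im v, hspan v⟩) (fun v => hLre M v) hT0 hT ha0 hab hb1.le hC1 hPP hmP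
    hJ0 hJ hPn hJn' hQc hD hη

end Summit.NavierStokesRegularity.NavierStokesRegularity.Theorems
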